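import Literature.NumberTheory.EllipticCurves.BarriosEtAl2025.QuadraticTwistAtTwoConductorProofs
import Literature.NumberTheory.EllipticCurves.OggFormulaPotGoodOrdinaryTwoProofs
import Literature.NumberTheory.DiophantineGeometry.ConductorAdditiveProofs
import HarnessLib

/-!
# «16 ∥ N descends», the semistable strata: `f₂(W) = 4` with `ord₂ j(W) ≤ 0`, or of type `II*` with `ord₂ Δ_min = 12`,
# twists by `d ≡ 3 (mod 4)` to a curve SEMISTABLE at `2` (route `ManinLocalTwoThree`, crux C2 `ManinOddAtFour`
# stmt-BirchSwinnertonDyer-22967; an g32 §11 candidate S-an-63 `SixteenExactDescends` / S-an-63L, strata (4,0) ∪ (4,1); cell bsd-f2-manin, p2 gen 14)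

Step 2 of an's S-an-63 «`f₂(W) = 4 ⟹ f₂(W ⊗ d) ≤ 3` for `d ≡ 3 (mod 4)`» (Barrios–Roy–Sahajpal–Tallana–Tobin–Wiersema 2025, Thm. 5.1,
Table localdata-dodd: no `f = 4` row keeps `f^d = 4`), for the rows whose twist is semistable — the strata `(f, f^d) = (4, 0), (4, 1)`:

* §1 **`ord₂ j ≤ 0`** (`|j|₂ = 2^ν`, `ν ≥ 0`: the potentially multiplicative curves and the potentially good ORDINARY ones; Kodaira
  rows `Iₙ*/(n+8)`, `n ≥ 5`, and `I₄*/12`).  Over `ℚ`, `W ≅ T^{(d₀)}` with `T = tateFormOfJ j(W)` semistable at `2` and `4 ∤ d₀`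
  (`exists_int_variableChange_eq_quadraticTwist_tateFormOfJ`); the tree's trichotomy (`QuadraticTwistTateFormTwoProofs`,
  `OggFormulaPotGoodOrdinaryTwoProofs`: `d₀ ≡ 1 (4)` semistable, `d₀ ≡ 2 (4)` `f = 6`, `d₀ ≡ 3 (4)` `f = 4`) forces `d₀ ≡ 3 (mod 4)`
  from `f₂(W) = 4`, and then `W ⊗ d ≅ T^{(d₀d)}` with `d₀ d ≡ 1 (mod 4)` is semistable: `f₂(W ⊗ d) ≤ 1`
  (`conductorExponent_quadraticTwist_le_one_of_valuation_j_eq_exp_of_eq_four`).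
* §2 **type `II*`, `ord₂ Δ_min = 12`** (the twists by `χ₋₄` of the good SUPERSINGULAR curves): the tree's
  `exists_variableChange_quadraticTwist_neg_one_of_IIstar_twelve` (`OggFormulaTwistTameIIstarTwoProofs`) exhibits a `2`-integral
  model of `W ⊗ (−1)` with unit discriminant, so `f₂(W ⊗ (−1)) = 0` (`conductorExponent_quadraticTwist_negOne_eq_zero_of_IIstar_twelve`).

Everything is read at the place `v ∋ 2` of `𝓞 ℚ` (where the tree's `j`-valuation API lives); the sequel moves it to the place of `ℤ`
(`WeierstrassCurve.conductorExponent_eq_of_primesEquiv_eq`) and adds the potentially good wild rows `II/4`, `I₀*/8`, `I₂*/10`, `I₃*/11`.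
HONEST FRAMING: local bookkeeping in print, kernel-checked by assembling tree theorems; nothing about BSD or Manin's conjecture is
proved; C2 OPEN. [cite: BarriosEtAl2025, Thm. 5.1 (arXiv:2501.03209 pp. 15–16), Table localdata-dodd, rows I₀ / I_{n>0} / II*, d ≡ 3 (mod 4)]
[cite: SilvermanATAEC1994, IV.9.4, Table 4.1 and IV.11.1] [cite: SilvermanAEC2009, VII.5 Prop. 5.1 and X.5 Cor. 5.4.1]
-/

set_option autoImplicit false
-- lint-debt: the directory name repeats the summit name (sibling precedent `ManinLocalTwoThreeQuadraticTwistAtTwoConductorBarriosRows.lean`)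
set_option linter.dupNamespace false

noncomputable section

open scoped Classical NumberField
open WeierstrassCurve IsDedekindDomain IsDedekindDomain.HeightOneSpectrum Rat.HeightOneSpectrum
  Literature.NumberTheory.DiophantineGeometry Literature.NumberTheory.EllipticCurves

namespace Summit.BirchSwinnertonDyer.BirchSwinnertonDyer.Theorems.ManinLocalTwoThree

section Place

variable (v : HeightOneSpectrum (𝓞 ℚ))

/-! ## §1 `ord₂ j ≤ 0` and `f₂ = 4`: the twist by `d ≡ 3 (mod 4)` is semistable at `2` -/

/-- **`f₂(W) = 4` with `|j(W)|₂ = 2^ν` (`ν ≥ 0`) pins the twist class: `W ≅ T^{(d₀)}` over `ℚ` with `T = tateFormOfJ j(W)` and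
`d₀ ≡ 3 (mod 4)`** — the classes `d₀ ≡ 1 (mod 4)` (semistable at `2`) and `d₀ ≡ 2 (mod 4)` (`f₂ = 6`) are excluded by `f₂ = 4`.
[cite: SilvermanATAEC1994, IV.11.1 and Table 4.1] [cite: SilvermanAEC2009, X.5 Cor. 5.4.1] -/
theorem exists_eq_quadraticTwist_tateFormOfJ_of_valuation_j_eq_exp_of_conductorExponent_eq_four
    (hv : natGenerator v = 2) (W : WeierstrassCurve ℚ) [W.IsElliptic] {ν : ℕ}
    (hν : v.valuation ℚ W.j = WithZero.exp (ν : ℤ)) (hf : W.conductorExponent v = 4) :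
    ∃ d₀ : ℤ, d₀ % 4 = 3 ∧ ∃ C : VariableChange ℚ, C • W = (tateFormOfJ W.j).quadraticTwist (d₀ : ℚ) := by
  obtain ⟨hj0, hj1728, -⟩ := W.j_ne_and_valuation_j_sub_eq_of_valuation_j_eq_exp v hv hν
  obtain ⟨d₀, hd₀0, hd₀4, C, hC⟩ := W.exists_int_variableChange_eq_quadraticTwist_tateFormOfJ hj0 hj1728
  refine ⟨d₀, ?_, C, hC⟩
  rcases (show d₀ % 4 = 1 ∨ d₀ % 4 = 2 ∨ d₀ % 4 = 3 by omega) with h | h | h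
  · exfalso
    have hna := W.not_hasAdditiveReductionAt_of_emod_four_eq_one_of_valuation_j_eq_exp v hv hν h hC
    exact hna ((WeierstrassCurve.two_le_conductorExponent_iff_holds v W).mp (by omega))
  · have h6 := (W.conductorExponent_eq_six_of_emod_four_eq_two_of_valuation_j_eq_exp v hv hν h hC).1
    omega
  · exact h

/-- **Stratum `ord₂ j ≤ 0` of «16 ∥ N descends»**: for `W/ℚ` elliptic with `|j(W)|₂ = 2^ν`, `ν ≥ 0`, and `f₂(W) = 4` (Kodaira `I₄*/12` if
`ν = 0`, `I*_{ν+4}/(ν+12)` if `ν ≥ 1`), the twist by any `d ≡ 3 (mod 4)` is SEMISTABLE at `2`: `W ⊗ d ≅ T^{(d₀d)}` with `d₀d ≡ 1 (mod 4)`,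
good (`ν = 0`) or multiplicative (`ν ≥ 1`).  Barrios et al. 2025 Thm. 5.1, rows `Iₙ≥5* → I_{n−4}` `(f,f^d) = (4,1)` and `I₄* → I₀` `(4,0)`.
[cite: BarriosEtAl2025, Thm. 5.1, Table localdata-dodd, rows I*_{n≥4} with v(a₁) = 1, d ≡ 3 (mod 4)] [cite: SilvermanAEC2009, X.5 Cor. 5.4.1] -/
theorem not_hasAdditiveReductionAt_quadraticTwist_of_valuation_j_eq_exp_of_eq_four
    (hv : natGenerator v = 2) (W : WeierstrassCurve ℚ) [W.IsElliptic] {ν : ℕ}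
    (hν : v.valuation ℚ W.j = WithZero.exp (ν : ℤ)) (hf : W.conductorExponent v = 4) {d : ℤ} (hd : d % 4 = 3) :
    ¬ (haveI := W.isElliptic_quadraticTwist (show ((d : ℤ) : ℚ) ≠ 0 by exact_mod_cast (show d ≠ 0 by omega));
      (W.quadraticTwist (d : ℚ)).HasAdditiveReductionAt v) := by
  have hd0 : (d : ℚ) ≠ 0 := by exact_mod_cast (show d ≠ 0 by omega)
  haveI := W.isElliptic_quadraticTwist hd0
  obtain ⟨d₀, hd₀, C, hC⟩ :=
    exists_eq_quadraticTwist_tateFormOfJ_of_valuation_j_eq_exp_of_conductorExponent_eq_four v hv W hν hf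
  -- the twist `W ⊗ d` is `T^{(d₀ d)}`, with the same `j`
  have hjd : (W.quadraticTwist (d : ℚ)).j = W.j := W.j_quadraticTwist hd0
  have hν' : v.valuation ℚ (W.quadraticTwist (d : ℚ)).j = WithZero.exp (ν : ℤ) := by rw [hjd]; exact hν
  have hC' : (⟨C.u, (d : ℚ) * C.r, 0, 0⟩ : VariableChange ℚ) • W.quadraticTwist (d : ℚ) =
      (tateFormOfJ (W.quadraticTwist (d : ℚ)).j).quadraticTwist ((d₀ * d : ℤ) : ℚ) := by
    rw [hjd, ← WeierstrassCurve.quadraticTwist_smul, hC, WeierstrassCurve.quadraticTwist_quadraticTwist]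
    push_cast
    ring_nf
  have hd' : (d₀ * d) % 4 = 1 := by rw [Int.mul_emod, hd₀, hd]; norm_num
  exact (W.quadraticTwist (d : ℚ)).not_hasAdditiveReductionAt_of_emod_four_eq_one_of_valuation_j_eq_exp v hv hν' hd' hC'

/-- **`f₂(W ⊗ d) ≤ 1`** in the situation of `not_hasAdditiveReductionAt_quadraticTwist_of_valuation_j_eq_exp_of_eq_four` (`f_v ≥ 2 ⟺` additive,
`two_le_conductorExponent_iff`). [cite: BarriosEtAl2025, Thm. 5.1, Table localdata-dodd, column (f, f^d) ∈ {(4,0), (4,1)}] -/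
theorem conductorExponent_quadraticTwist_le_one_of_valuation_j_eq_exp_of_eq_four
    (hv : natGenerator v = 2) (W : WeierstrassCurve ℚ) [W.IsElliptic] {ν : ℕ}
    (hν : v.valuation ℚ W.j = WithZero.exp (ν : ℤ)) (hf : W.conductorExponent v = 4) {d : ℤ} (hd : d % 4 = 3) :
    (haveI := W.isElliptic_quadraticTwist (show ((d : ℤ) : ℚ) ≠ 0 by exact_mod_cast (show d ≠ 0 by omega));
      (W.quadraticTwist (d : ℚ)).conductorExponent v) ≤ 1 := by
  have hd0 : (d : ℚ) ≠ 0 := by exact_mod_cast (show d ≠ 0 by omega)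
  haveI := W.isElliptic_quadraticTwist hd0
  have hna := not_hasAdditiveReductionAt_quadraticTwist_of_valuation_j_eq_exp_of_eq_four v hv W hν hf hd
  by_contra h
  exact hna ((WeierstrassCurve.two_le_conductorExponent_iff_holds v (W.quadraticTwist (d : ℚ))).mp (by omega))

/-- **`1 ≤ |j|₂` form** (`ord₂ j ≤ 0`): `f₂(W) = 4 ⟹ f₂(W ⊗ d) ≤ 1` for `d ≡ 3 (mod 4)`.
[cite: BarriosEtAl2025, Thm. 5.1, Table localdata-dodd, rows I₄* (n = 4, v(a₁) = 1) and I*_{n≥5} (v(a₁) = 1), d ≡ 3 (mod 4)] -/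
theorem conductorExponent_quadraticTwist_le_one_of_one_le_valuation_j_of_eq_four
    (hv : natGenerator v = 2) (W : WeierstrassCurve ℚ) [W.IsElliptic] (hj : 1 ≤ v.valuation ℚ W.j)
    (hf : W.conductorExponent v = 4) {d : ℤ} (hd : d % 4 = 3) :
    (haveI := W.isElliptic_quadraticTwist (show ((d : ℤ) : ℚ) ≠ 0 by exact_mod_cast (show d ≠ 0 by omega));
      (W.quadraticTwist (d : ℚ)).conductorExponent v) ≤ 1 := by
  rcases hj.eq_or_lt with h | h
  · exact conductorExponent_quadraticTwist_le_one_of_valuation_j_eq_exp_of_eq_four v hv W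
      (W.valuation_j_eq_exp_zero_of_eq_one v h.symm) hf hd
  · obtain ⟨ν, -, hν⟩ := W.exists_valuation_j_eq_exp v h
    exact conductorExponent_quadraticTwist_le_one_of_valuation_j_eq_exp_of_eq_four v hv W hν hf hd

end Place

end Summit.BirchSwinnertonDyer.BirchSwinnertonDyer.Theorems.ManinLocalTwoThree

end
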